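import Literature.NumberTheory.LFunctions.DirichletExplicitRegionRealZeros
import Literature.NumberTheory.LFunctions.ExplicitExceptionalZeroBoundsEvenDerivative
import Literature.NumberTheory.LFunctions.ExplicitLogFreeZeroDensityDirichlet
import Literature.NumberTheory.LFunctions.SiegelZeroClassNumberBound
import HarnessLib

/-!
# McCurley's Theorem 1 at real points: the consumers re-pointed to the proved real-zero clause

Topic `Literature/NumberTheory/LFunctions` (namespace `Literature.NumberTheory.LFunctions`). Pure
proof file (theorems only; no definition, no named fact). `DirichletExplicitRegionRealZeros.lean`
proves the real-zero clause of McCurley 1984, Theorem 1 (`mccurley1984_theorem1_realZeros`: at most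
one real zero of `∏_χ L(s, χ)` in `σ ≥ 1 − 1/(R log max(q,10))`, `R = 9.645908801`, from a quadratic
non-principal character; `McCurleyStechkin.quadratic_of_realZero_window`). The tree's consumers of the
named fact `McCurley1984_theorem1` (K. S. McCurley, J. Number Theory 19 (1984), Thm 1) that evaluate
it at REAL points only are restated here WITHOUT that hypothesis:

* `lfunction_ofReal_ne_zero_of_noExceptionalZeroUpTo` — the real-point form of
  `zeroFreeRegionUpTo_of_noExceptionalZeroUpTo` (a no-exceptional-zero table for the primitive
  quadratic characters up to `Q` removes the exception: no `L(s, χ)`, `χ` mod `q ≤ Q`, vanishes at a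
  real `σ ≠ 1` with `σ > 1 − 1/(R' log max(q,10))`, `R' ≥ R`, `R'c₀ ≥ 1`);
* `BGTZ2025.no_landauSiegelZero_upTo_1e9'`, `…_1e10'` (Lu–Zaman–Zhao print fact), `…_1e10_of_leaf'`,
  `…_3e10_of_leaf'`, `…_4e10_of_leaf'` and the `repulsion_vacuous_…'` twins — the statements of
  `ExplicitDeuringHeilbronnDirichlet.lean` minus the hypothesis `McCurley1984_theorem1`;
* `BGTZ2025.hypothesisB_half_of_real_clause'`, `BGTZ2025.theorem28_bordignon_of_watkins_platt`,
  `BGTZ2025.hypothesisB_of_watkins_platt` — Benli–Goel–Twiss–Zaman's Theorem 2.8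
  (`BGTZ2025.theorem28_bordignon = HypothesisB 100 (1/2)`) now DISCHARGED modulo the three
  certified-computation facts `watkins2004_theorem`, `watkins2004_table4`, `platt2016_theorem71`
  alone (the printed ZFR of McCurley is no longer an input).
* (appended) `ThornerZaman2024.betaOne_le_of_noExceptionalZeroUpTo`,
  `tenth_le_dhFactor_of_noExceptionalZeroUpTo`, `…_upTo_1e10_of_leaf'`, `…_upTo_1e10'` — the
  Deuring–Heilbronn factor `min{1, (1 − β₁(Q)) log Q} ≥ 1/10` of Thorner–Zaman's Theorem 1.2 on a
  certified range, from the table alone; `no_landauSiegelZero_quadraticField_upTo_1e10'/_of_leaf'/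
  _3e10_of_leaf'` — the class-number-side readings of `SiegelZeroClassNumberBound.lean`, McCurley-free.

## References

* K. S. McCurley, J. Number Theory 19 (1984) 7–32, Theorem 1. [McCurley1984ZFR]
* K. Benli, S. Goel, H. Twiss, A. Zaman, arXiv:2410.06082, Hypothesis 2.6, Theorem 2.8,
  Corollary 1.1 (Remarks). [BenliGoelTwissZaman2025]
* R. F. Lu, A. Zaman, H. Zhao, Math. Comp. (2026), Theorem 1.1, Corollary 1.2. [LuZamanZhao2026]
* D. J. Platt, Math. Comp. 85 (2016), Theorem 7.1. [Platt2016GRH]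
* M. Watkins, Math. Comp. 73 (2004), Table 4. [Watkins2004ClassNumbers]
-/

noncomputable section

open Real Complex

namespace Literature.NumberTheory.LFunctions

open McCurleyStechkin DirichletCharacter

/-! ## The table removes the exception — at real points, without McCurley's fact -/

/-- **Real-point zero-free region from a no-exceptional-zero table, unconditionally.** Let
`NoExceptionalZeroUpTo Q c₀` hold and `R' ≥ 9.645908801`, `R' c₀ ≥ 1`. Then for `3 ≤ q ≤ Q`, every `χ`
mod `q` and every real `σ ≠ 1` with `σ > 1 − 1/(R' log max(q,10))`: `L(σ, χ) ≠ 0`. (A zero there is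
a real zero in McCurley's window, hence `χ` is quadratic non-principal and `0 < σ < 1`
(`quadratic_of_realZero_window`, PROVED); but `1/(R' log max(q,10)) ≤ c₀/log q`, so the table forbids it.)
[cite: McCurley1984ZFR, Theorem 1] [cite: BennettMartinOBryantRechnitzer2018, Proposition 6.18] -/
theorem lfunction_ofReal_ne_zero_of_noExceptionalZeroUpTo {Q : ℕ} {c₀ : ℝ}
    (hN : NoExceptionalZeroUpTo Q c₀) {R' : ℝ} (hRR : 9.645908801 ≤ R') (hRc : 1 ≤ R' * c₀)
    {q : ℕ} [NeZero q] (hq3 : 3 ≤ q) (hqQ : q ≤ Q) (χ : DirichletCharacter ℂ q) {σ : ℝ} (hs : σ ≠ 1)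
    (hr : 1 - 1 / (R' * Real.log (max (q : ℝ) 10)) < σ) : χ.LFunction σ ≠ 0 := by
  intro hz
  have hq3r : (3 : ℝ) ≤ (q : ℝ) := by exact_mod_cast hq3
  have hlogq : 1 < Real.log q := by
    have hlog3 : 1 < Real.log 3 := by
      have h := Real.exp_one_lt_d9
      rw [Real.lt_log_iff_exp_lt (by norm_num)]
      linarith
    exact lt_of_lt_of_le hlog3 (Real.log_le_log (by norm_num) hq3r)
  have hlogM : Real.log q ≤ Real.log (max (q : ℝ) 10) :=
    Real.log_le_log (by linarith) (le_max_left _ _)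
  have hLpos : 0 < Real.log (max (q : ℝ) 10) := by linarith
  -- McCurley's window contains the `R'`-window
  have hmono : 1 / (R' * Real.log (max (q : ℝ) 10)) ≤ 1 / (9.645908801 * Real.log (max (q : ℝ) 10)) :=
    one_div_le_one_div_of_le (by positivity) (mul_le_mul_of_nonneg_right hRR hLpos.le)
  obtain ⟨hne, hsq, hσ0, -⟩ := quadratic_of_realZero_window χ hs (by linarith) hz
  have hquad : χ.IsQuadratic := MulChar.isQuadratic_iff_sq_eq_one.mpr hsq
  -- `1/(R' log max(q,10)) ≤ 1/(R' log q) ≤ c₀/log q`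
  have hRlog : 0 < R' * Real.log q := mul_pos (by linarith) (by linarith)
  have h1 : 1 / (R' * Real.log (max (q : ℝ) 10)) ≤ 1 / (R' * Real.log q) :=
    one_div_le_one_div_of_le hRlog (mul_le_mul_of_nonneg_left hlogM (by linarith))
  have h2 : 1 / (R' * Real.log q) ≤ c₀ / Real.log q := by
    rw [div_le_div_iff₀ hRlog (by linarith)]
    nlinarith
  have hσw : 1 - c₀ / Real.log q ≤ σ := by linarith
  exact hN.lfunction_ne_zero hqQ χ hquad hne hσ0 hσw hz

namespace BGTZ2025

/-- **No Landau–Siegel zero in the `c = 1/10` window from a wide leaf, unconditionally**: under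
`NoRealZeroUpTo Q`, for `10 ≤ q ≤ Q`, every `χ` mod `q` and every real `β₁ ∈ (1 − 1/(10 log q), 1)`,
`L(β₁, χ) ≠ 0`. [cite: BenliGoelTwissZaman2025, Corollary 1.1 (Remarks)] [cite: McCurley1984ZFR, Theorem 1] -/
theorem no_landauSiegelZero_of_noRealZeroUpTo {Q : ℕ} (hW : NoRealZeroUpTo Q) {q : ℕ} [NeZero q]
    (hq10 : 10 ≤ q) (hqQ : q ≤ Q) (χ : DirichletCharacter ℂ q) {β₁ : ℝ}
    (hlo : 1 - 1 / (10 * Real.log q) < β₁) (hhi : β₁ < 1) : χ.LFunction β₁ ≠ 0 := by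
  have hq3 : 3 ≤ q := le_trans (by norm_num) hq10
  have hN : NoExceptionalZeroUpTo Q (1 / 10) := NoRealZeroUpTo.noExceptionalZeroUpTo hW (1 / 10)
  have hq10r : (10 : ℝ) ≤ q := by exact_mod_cast hq10
  have hmax : max (q : ℝ) 10 = q := max_eq_left hq10r
  refine lfunction_ofReal_ne_zero_of_noExceptionalZeroUpTo hN (R' := 10) (by norm_num) (by norm_num)
    hq3 hqQ χ hhi.ne ?_
  rw [hmax]; exact hlo

/-- **Instance `Q = 10⁹`** (leaf `NoRealZeroUpTo_1e9` alone): the statement of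
`no_landauSiegelZero_upTo_1e9` without `McCurley1984_theorem1`.
[cite: BenliGoelTwissZaman2025, Corollary 1.1 (Remarks)] [cite: McCurley1984ZFR, Theorem 1] -/
theorem no_landauSiegelZero_upTo_1e9' (hW : NoRealZeroUpTo_1e9) {q : ℕ} [NeZero q] (hq10 : 10 ≤ q)
    (hqQ : q ≤ 1000000000) (χ : DirichletCharacter ℂ q) {β₁ : ℝ}
    (hlo : 1 - 1 / (10 * Real.log q) < β₁) (hhi : β₁ < 1) : χ.LFunction β₁ ≠ 0 :=
  no_landauSiegelZero_of_noRealZeroUpTo hW hq10 hqQ χ hlo hhi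

/-- `Repulsion c₁ c₂ c₃ c₄ q T` holds vacuously for `400 000 < q ≤ 10⁹` under `NoRealZeroUpTo_1e9`
alone. [cite: BenliGoelTwissZaman2025, Corollary 1.1 (Remarks)] -/
theorem repulsion_vacuous_upTo_1e9' (hW : NoRealZeroUpTo_1e9) (c₁ c₂ c₃ c₄ : ℝ) {q : ℕ} [NeZero q]
    (hq : 400000 < q) (hqQ : q ≤ 1000000000) (T : ℝ) : Repulsion c₁ c₂ c₃ c₄ q T := by
  intro χ₁ β₁ hlo hhi hz
  exact absurd hz (no_landauSiegelZero_upTo_1e9' hW (le_trans (by norm_num) hq.le) hqQ χ₁ hlo hhi)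

/-- **Instance `Q = 10¹⁰`, PRINT version** (Lu–Zaman–Zhao 2026, Thm 1.1, alone): for
`10 ≤ q ≤ 10¹⁰`, no `L(s, χ)`, `χ` mod `q`, has a real zero in `(1 − 1/(10 log q), 1)` — Corollary 1.2
of the source at real points, McCurley's fact no longer needed for them.
[cite: LuZamanZhao2026, Corollary 1.2] [cite: McCurley1984ZFR, Theorem 1] -/
theorem no_landauSiegelZero_upTo_1e10' (h11 : luZamanZhao2026_theorem11) {q : ℕ} [NeZero q]
    (hq10 : 10 ≤ q) (hqQ : q ≤ 10 ^ 10) (χ : DirichletCharacter ℂ q) {β₁ : ℝ}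
    (hlo : 1 - 1 / (10 * Real.log q) < β₁) (hhi : β₁ < 1) : χ.LFunction β₁ ≠ 0 := by
  intro hz
  have hq10r : (10 : ℝ) ≤ q := by exact_mod_cast hq10
  have hlogq : 1 < Real.log q := by
    rw [Real.lt_log_iff_exp_lt (by linarith)]
    have := Real.exp_one_lt_d9
    linarith
  have hmax : max (q : ℝ) 10 = q := max_eq_left hq10r
  have hwin : 1 - 1 / (9.645908801 * Real.log (max (q : ℝ) 10)) ≤ β₁ := by
    rw [hmax]
    have : 1 / (10 * Real.log q) ≤ 1 / (9.645908801 * Real.log q) :=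
      one_div_le_one_div_of_le (by positivity) (by nlinarith)
    linarith
  obtain ⟨hne, hsq, -, -⟩ := quadratic_of_realZero_window χ hhi.ne hwin hz
  have hquad : χ.IsQuadratic := MulChar.isQuadratic_iff_sq_eq_one.mpr hsq
  have hσ : 1 - 1 / (5 * Real.log q) ≤ β₁ := by
    have : 1 / (10 * Real.log q) ≤ 1 / (5 * Real.log q) :=
      one_div_le_one_div_of_le (by positivity) (by nlinarith)
    linarith
  exact h11 q hqQ χ hquad hne β₁ hσ hz

/-- `Repulsion c₁ c₂ c₃ c₄ q T` holds vacuously for `400 000 < q ≤ 10¹⁰` under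
`luZamanZhao2026_theorem11` alone. [cite: BenliGoelTwissZaman2025, Corollary 1.1 (Remarks)]
[cite: LuZamanZhao2026, Corollary 1.2] -/
theorem repulsion_vacuous_upTo_1e10' (h11 : luZamanZhao2026_theorem11) (c₁ c₂ c₃ c₄ : ℝ) {q : ℕ}
    [NeZero q] (hq : 400000 < q) (hqQ : q ≤ 10 ^ 10) (T : ℝ) : Repulsion c₁ c₂ c₃ c₄ q T := by
  intro χ₁ β₁ hlo hhi hz
  exact absurd hz (no_landauSiegelZero_upTo_1e10' h11 (le_trans (by norm_num) hq.le) hqQ χ₁ hlo hhi)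

/-- **Instance `Q = 10¹⁰`, CERTIFIED-NUMERICS version** (leaf `NoRealZeroUpTo_1e10` alone).
[cite: BenliGoelTwissZaman2025, Corollary 1.1 (Remarks)] [cite: McCurley1984ZFR, Theorem 1] -/
theorem no_landauSiegelZero_upTo_1e10_of_leaf' (hW : NoRealZeroUpTo_1e10) {q : ℕ} [NeZero q]
    (hq10 : 10 ≤ q) (hqQ : q ≤ 10 ^ 10) (χ : DirichletCharacter ℂ q) {β₁ : ℝ}
    (hlo : 1 - 1 / (10 * Real.log q) < β₁) (hhi : β₁ < 1) : χ.LFunction β₁ ≠ 0 :=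
  no_landauSiegelZero_of_noRealZeroUpTo hW hq10 (by norm_num at hqQ ⊢; exact hqQ) χ hlo hhi

/-- `Repulsion c₁ c₂ c₃ c₄ q T` for `400 000 < q ≤ 10¹⁰` under the leaf `NoRealZeroUpTo_1e10` alone.
[cite: BenliGoelTwissZaman2025, Corollary 1.1 (Remarks)] -/
theorem repulsion_vacuous_upTo_1e10_of_leaf' (hW : NoRealZeroUpTo_1e10) (c₁ c₂ c₃ c₄ : ℝ) {q : ℕ}
    [NeZero q] (hq : 400000 < q) (hqQ : q ≤ 10 ^ 10) (T : ℝ) : Repulsion c₁ c₂ c₃ c₄ q T := by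
  intro χ₁ β₁ hlo hhi hz
  exact absurd hz
    (no_landauSiegelZero_upTo_1e10_of_leaf' hW (le_trans (by norm_num) hq.le) hqQ χ₁ hlo hhi)

/-- **Instance `Q = 3·10¹⁰`** (wide rung leaf `NoRealZeroUpTo_3e10` alone).
[cite: BenliGoelTwissZaman2025, Corollary 1.1 (Remarks)] [cite: McCurley1984ZFR, Theorem 1] -/
theorem no_landauSiegelZero_upTo_3e10_of_leaf' (hW : NoRealZeroUpTo_3e10) {q : ℕ} [NeZero q]
    (hq10 : 10 ≤ q) (hqQ : q ≤ 3 * 10 ^ 10) (χ : DirichletCharacter ℂ q) {β₁ : ℝ}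
    (hlo : 1 - 1 / (10 * Real.log q) < β₁) (hhi : β₁ < 1) : χ.LFunction β₁ ≠ 0 :=
  no_landauSiegelZero_of_noRealZeroUpTo hW hq10 (by norm_num at hqQ ⊢; exact hqQ) χ hlo hhi

/-- `Repulsion c₁ c₂ c₃ c₄ q T` for `400 000 < q ≤ 3·10¹⁰` under the leaf `NoRealZeroUpTo_3e10` alone.
[cite: BenliGoelTwissZaman2025, Corollary 1.1 (Remarks)] -/
theorem repulsion_vacuous_upTo_3e10_of_leaf' (hW : NoRealZeroUpTo_3e10) (c₁ c₂ c₃ c₄ : ℝ) {q : ℕ}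
    [NeZero q] (hq : 400000 < q) (hqQ : q ≤ 3 * 10 ^ 10) (T : ℝ) : Repulsion c₁ c₂ c₃ c₄ q T := by
  intro χ₁ β₁ hlo hhi hz
  exact absurd hz
    (no_landauSiegelZero_upTo_3e10_of_leaf' hW (le_trans (by norm_num) hq.le) hqQ χ₁ hlo hhi)

/-- **Instance `Q = 4·10¹⁰`** (wide rung leaf `NoRealZeroUpTo_4e10` alone).
[cite: BenliGoelTwissZaman2025, Corollary 1.1 (Remarks)] [cite: McCurley1984ZFR, Theorem 1] -/
theorem no_landauSiegelZero_upTo_4e10_of_leaf (hW : NoRealZeroUpTo_4e10) {q : ℕ} [NeZero q]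
    (hq10 : 10 ≤ q) (hqQ : q ≤ 4 * 10 ^ 10) (χ : DirichletCharacter ℂ q) {β₁ : ℝ}
    (hlo : 1 - 1 / (10 * Real.log q) < β₁) (hhi : β₁ < 1) : χ.LFunction β₁ ≠ 0 :=
  no_landauSiegelZero_of_noRealZeroUpTo hW hq10 (by norm_num at hqQ ⊢; exact hqQ) χ hlo hhi

/-- `Repulsion c₁ c₂ c₃ c₄ q T` for `400 000 < q ≤ 4·10¹⁰` under the leaf `NoRealZeroUpTo_4e10` alone.
[cite: BenliGoelTwissZaman2025, Corollary 1.1 (Remarks)] -/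
theorem repulsion_vacuous_upTo_4e10_of_leaf (hW : NoRealZeroUpTo_4e10) (c₁ c₂ c₃ c₄ : ℝ) {q : ℕ}
    [NeZero q] (hq : 400000 < q) (hqQ : q ≤ 4 * 10 ^ 10) (T : ℝ) : Repulsion c₁ c₂ c₃ c₄ q T := by
  intro χ₁ β₁ hlo hhi hz
  exact absurd hz
    (no_landauSiegelZero_upTo_4e10_of_leaf hW (le_trans (by norm_num) hq.le) hqQ χ₁ hlo hhi)

/-! ## Hypothesis B (BGTZ 2025, Hypothesis 2.6 / Theorem 2.8) without McCurley's fact -/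

/-- The principal character has no real zero in `(0,1)`. [folklore] -/
private theorem LFunction_one_ofReal_ne_zero₃ {q : ℕ} [NeZero q] {σ : ℝ} (h0 : 0 < σ) (h1 : σ < 1) :
    (1 : DirichletCharacter ℂ q).LFunction σ ≠ 0 := by
  have hs1 : (σ : ℂ) ≠ 1 := by
    intro h; have := congrArg Complex.re h; simp at this; linarith
  have key : (1 : DirichletCharacter ℂ q).LFunction σ =
      (∏ p ∈ q.primeFactors, (1 - (p : ℂ) ^ (-(σ : ℂ)))) * riemannZeta σ :=
    DirichletCharacter.LFunctionTrivChar_eq_mul_riemannZeta hs1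
  rw [key]
  refine mul_ne_zero (Finset.prod_ne_zero_iff.mpr fun p hp => ?_)
    (riemannZeta_ne_zero_of_mem_Ioo_holds σ h0 h1)
  have hp := Nat.prime_of_mem_primeFactors hp
  have hlt : ‖(p : ℂ) ^ (-(σ : ℂ))‖ < 1 := by
    rw [Complex.norm_natCast_cpow_of_pos hp.pos]
    simp only [neg_re, ofReal_re]
    exact Real.rpow_lt_one_of_one_lt_of_neg (by exact_mod_cast hp.one_lt) (by linarith)
  intro h
  rw [sub_eq_zero] at h
  rw [← h, norm_one] at hlt
  exact lt_irrefl _ hlt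

/-- **`HypothesisB B (1/2)` reduces to its REAL-CHARACTER clause at `q > 4·10⁵`, modulo Platt 2016
Thm 7.1 ONLY** — the statement of `BGTZ2025.hypothesisB_half_of_real_clause` without
`McCurley1984_theorem1`: for `q > 4·10⁵` a zero `β₁ > 1 − 1/(10 log q)` of a COMPLEX `χ` is now
excluded by the theorem `McCurleyStechkin.realZero_lt_of_sq_ne_one`.
[cite: BenliGoelTwissZaman2025, Hypothesis 2.6 and Theorem 2.8] [cite: Platt2016GRH, Theorem 7.1]
[cite: McCurley1984ZFR, Theorem 1] -/
theorem hypothesisB_half_of_real_clause' {B : ℝ}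
    (hreal : ∀ (q : ℕ) [NeZero q], 400000 < q → ∀ χ : DirichletCharacter ℂ q, χ.IsQuadratic → χ ≠ 1 →
      ∀ β : ℝ, 1 - 1 / (10 * Real.log q) < β → β < 1 → χ.LFunction β = 0 →
        β < 1 - B / (Real.sqrt q * Real.log q ^ 2))
    (hP : platt2016_theorem71) : BGTZ2025.HypothesisB B (1 / 2) := by
  intro q _ hq3 χ β₁ hlo hβ1 hz
  have hq0 : (0 : ℝ) < q := by exact_mod_cast (show 0 < q by omega)
  have hq3R : (3 : ℝ) ≤ q := by exact_mod_cast hq3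
  have hlog3 : 1 < Real.log 3 := by
    rw [Real.lt_log_iff_exp_lt (by norm_num)]
    linarith [Real.exp_one_lt_d9]
  have hlogq : 1 < Real.log q := lt_of_lt_of_le hlog3 (Real.log_le_log (by norm_num) hq3R)
  have hβ0 : 0 < β₁ := by
    have : 1 / (10 * Real.log q) < 1 := by
      rw [div_lt_one (by positivity)]; linarith
    linarith
  have hsqrt : (q : ℝ) ^ (1 / 2 : ℝ) = Real.sqrt q := (Real.sqrt_eq_rpow (q : ℝ)).symm
  rw [hsqrt]
  -- the principal character has no real zero in `(0,1)`
  by_cases hχ1 : χ = 1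
  · subst hχ1
    exact absurd hz (LFunction_one_ofReal_ne_zero₃ hβ0 hβ1)
  rcases le_or_gt q 400000 with hq | hq
  · -- Platt: no zero off the line up to height `10⁸/q`; a real zero in `(0,1)` would lie on `Re s = ½`
    have hgrh := grhUpTo_of_platt2016 (q := q) hP hq χ hχ1
    have hhalf : ((β₁ : ℂ)).re = 1 / 2 :=
      hgrh β₁ hz (by simpa using hβ0) (by simpa using hβ1)
        (by simp only [Complex.ofReal_im, abs_zero]; positivity)
    simp at hhalf
    have : 1 / (10 * Real.log q) ≤ 1 / 10 := by
      rw [div_le_div_iff₀ (by positivity) (by norm_num)]; nlinarith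
    linarith
  · -- `q > 4·10⁵`
    by_cases hsq : χ ^ 2 = 1
    · exact hreal q hq χ (MulChar.isQuadratic_iff_sq_eq_one.mpr hsq) hχ1 β₁ hlo hβ1 hz
    · -- complex `χ`: no real zero that close to `1` (McCurley's region at real points, PROVED)
      exfalso
      have hq10 : (10 : ℝ) ≤ q := by
        have : (400000 : ℝ) < q := by exact_mod_cast hq
        linarith
      have hmax : max (q : ℝ) 10 = q := max_eq_left hq10
      have hlt := realZero_lt_of_sq_ne_one χ hsq hβ0 hz
      rw [hmax] at hlt
      have : 1 / (10 * Real.log q) ≤ 1 / (9.645908801 * Real.log q) :=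
        div_le_div_of_nonneg_left (by norm_num) (by positivity) (by nlinarith)
      linarith

/-- **BGTZ 2025, Theorem 2.8 — `BGTZ2025.theorem28_bordignon` (`HypothesisB 100 (1/2)`) DISCHARGED
modulo the THREE certified-computation facts `watkins2004_theorem`, `watkins2004_table4`,
`platt2016_theorem71`** (McCurley's printed zero-free region is no longer an input: its real-zero clause
is a theorem of the tree). [cite: BenliGoelTwissZaman2025, Theorem 2.8] [cite: Platt2016GRH, Theorem 7.1]
[cite: Watkins2004ClassNumbers, Table 4 p. 936] -/
theorem theorem28_bordignon_of_watkins_platt (hZ : watkins2004_theorem)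
    (hW : QuadraticFields.watkins2004_table4) (hP : platt2016_theorem71) : BGTZ2025.theorem28_bordignon :=
  hypothesisB_half_of_real_clause'
    (fun _ _ hq _ hquad hχ _ _ hβ1 hz => BGTZ2025.realZero_lt_hundred_of_watkins_platt hZ hW hP hq hquad hχ hβ1 hz)
    hP

/-- `BGTZ2025.HypothesisB B (1/2)` for every `B ≤ 100` from the same three facts.
[cite: BenliGoelTwissZaman2025, Hypothesis 2.6 and Theorem 2.8] -/
theorem hypothesisB_of_watkins_platt (hZ : watkins2004_theorem) (hW : QuadraticFields.watkins2004_table4)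
    (hP : platt2016_theorem71) {B : ℝ} (hB : B ≤ 100) : BGTZ2025.HypothesisB B (1 / 2) :=
  BGTZ2025.HypothesisB.anti hB (theorem28_bordignon_of_watkins_platt hZ hW hP)

end BGTZ2025


/-! ## Appended: the Deuring–Heilbronn factor of Thorner–Zaman's Theorem 1.2 and the quadratic-field
readings, from the tables alone (no McCurley hypothesis) -/

namespace ThornerZaman2024

/-- **`β₁(Q) ≤ 1 − 1/(10 log Q)` from a no-exceptional-zero table alone**: under
`NoExceptionalZeroUpTo Q₀ c₀` with `10 c₀ ≥ 1`, for `10 ≤ Q ≤ Q₀` every real zero `β` of a primitive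
`L(s,χ)` of modulus `q ≤ Q` has `β ≤ 1 − 1/(10 log Q)` (`q ≥ 3`: `lfunction_ofReal_ne_zero_of_noExceptionalZeroUpTo`
with `R' = 10` and `max(q,10) ≤ Q`; `q = 2`: no primitive character; `q = 1`: the real zeros of `ζ` are
negative). The statement of `betaOne_le_of_zeroFreeRegionUpTo` with the table in place of the region.
[cite: ThornerZaman2024LogFree, Theorem 1.2 (the factor min{1,(1−β₁(Q))log Q})] [cite: McCurley1984ZFR, Theorem 1] -/
theorem betaOne_le_of_noExceptionalZeroUpTo {Q₀ : ℕ} {c₀ : ℝ} (hN : NoExceptionalZeroUpTo Q₀ c₀)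
    (hc : 1 ≤ 10 * c₀) {Q : ℝ} (h10 : 10 ≤ Q) (hQ : Q ≤ Q₀) :
    betaOne Q ≤ 1 - 1 / (10 * Real.log Q) := by
  have hlogQ : 1 < Real.log Q := by
    rw [Real.lt_log_iff_exp_lt (by linarith)]
    have := Real.exp_one_lt_d9
    linarith
  have hlog0 : 0 < Real.log Q := by linarith
  have hbound0 : (0 : ℝ) < 1 - 1 / (10 * Real.log Q) := by
    have : 1 / (10 * Real.log Q) < 1 := by
      rw [div_lt_one (by positivity)]; linarith
    linarith
  apply csSup_le (realZeroSet_nonempty (by linarith))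
  rintro β ⟨i, hi, χ, hprim, hzero⟩
  -- the modulus `q = i + 1 ≤ ⌊Q⌋ ≤ Q`
  have hq : ((i + 1 : ℕ) : ℝ) ≤ Q := by
    have h1 : i + 1 ≤ ⌊Q⌋₊ := hi
    have h2 : ((⌊Q⌋₊ : ℕ) : ℝ) ≤ Q := Nat.floor_le (by linarith)
    exact le_trans (by exact_mod_cast h1) h2
  rcases Nat.lt_or_ge (i + 1) 3 with hsmall | hq3
  · -- modulus 1 or 2
    have hi01 : i = 0 ∨ i = 1 := by omega
    rcases hi01 with rfl | rfl
    · -- `q = 1`: `ζ`; its real zeros are negative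
      have hζ : riemannZeta β = 0 := by
        rwa [DirichletCharacter.LFunction_modOne_eq] at hzero
      by_contra hlt
      rw [not_le] at hlt
      have hβ0 : 0 < β := lt_trans hbound0 hlt
      rcases lt_or_ge β 1 with hβ1 | hβ1
      · exact riemannZeta_ofReal_ne_zero_of_pos_of_lt_one β hβ0 hβ1 hζ
      · exact riemannZeta_ne_zero_of_one_le_re (by simpa using hβ1) hζ
    · -- `q = 2`: every character mod `2` is trivial (one unit), hence of conductor `1`, imprimitive
      exfalso
      have hsub : Subsingleton (ZMod (1 + 1))ˣ := by
        refine Fintype.card_le_one_iff_subsingleton.mp ?_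
        rw [ZMod.card_units_eq_totient]
        decide
      have hχ : χ = 1 :=
        MulChar.ext fun a => by rw [Subsingleton.elim a 1, Units.val_one, map_one, map_one]
      rw [DirichletCharacter.isPrimitive_def, hχ, DirichletCharacter.conductor_one] at hprim
      omega
  · -- `q ≥ 3`: the table at the real point `β`
    haveI : NeZero (i + 1) := ⟨by omega⟩
    by_contra hlt
    rw [not_le] at hlt
    have hne1 : β ≠ 1 := by
      intro h
      have hq2 : 2 ≤ i + 1 := by omega
      have hχne : χ ≠ 1 := SiegelZeroQuality.ne_one_of_isPrimitive hprim hq2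
      exact DirichletCharacter.LFunction_ne_zero_of_one_le_re χ (Or.inl hχne)
        (by rw [h]; simp) hzero
    have hqQ₀ : i + 1 ≤ Q₀ := by
      have : ((i + 1 : ℕ) : ℝ) ≤ (Q₀ : ℝ) := hq.trans hQ
      exact_mod_cast this
    refine lfunction_ofReal_ne_zero_of_noExceptionalZeroUpTo hN (R' := 10) (by norm_num) (by linarith)
      hq3 hqQ₀ χ hne1 ?_ hzero
    -- `1 − 1/(10 log max(q,10)) ≤ 1 − 1/(10 log Q) < β`
    have hmax : max ((i + 1 : ℕ) : ℝ) 10 ≤ Q := max_le hq h10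
    have hmax10 : (10 : ℝ) ≤ max ((i + 1 : ℕ) : ℝ) 10 := le_max_right _ _
    have hlogmax : Real.log (max ((i + 1 : ℕ) : ℝ) 10) ≤ Real.log Q :=
      Real.log_le_log (by linarith) hmax
    have hlogmax0 : 0 < Real.log (max ((i + 1 : ℕ) : ℝ) 10) := by
      have : 1 < Real.log (max ((i + 1 : ℕ) : ℝ) 10) := by
        rw [Real.lt_log_iff_exp_lt (by linarith)]
        have := Real.exp_one_lt_d9
        linarith
      linarith
    have hcmp : 1 / (10 * Real.log Q) ≤ 1 / (10 * Real.log (max ((i + 1 : ℕ) : ℝ) 10)) :=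
      one_div_le_one_div_of_le (by positivity) (by nlinarith)
    linarith

/-- **The Deuring–Heilbronn factor is `≥ 1/10` on `[10, Q₀]` under a no-exceptional-zero table
alone**: `1/10 ≤ min{1, (1 − β₁(Q)) log Q}` for `10 ≤ Q ≤ Q₀` under `NoExceptionalZeroUpTo Q₀ c₀`,
`10c₀ ≥ 1`. [cite: ThornerZaman2024LogFree, Theorem 1.2] [cite: McCurley1984ZFR, Theorem 1] -/
theorem tenth_le_dhFactor_of_noExceptionalZeroUpTo {Q₀ : ℕ} {c₀ : ℝ} (hN : NoExceptionalZeroUpTo Q₀ c₀)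
    (hc : 1 ≤ 10 * c₀) {Q : ℝ} (h10 : 10 ≤ Q) (hQ : Q ≤ Q₀) :
    1 / 10 ≤ min 1 ((1 - betaOne Q) * Real.log Q) := by
  have hlogQ : 1 < Real.log Q := by
    rw [Real.lt_log_iff_exp_lt (by linarith)]
    have := Real.exp_one_lt_d9
    linarith
  have hβ := betaOne_le_of_noExceptionalZeroUpTo hN hc h10 hQ
  refine le_min (by norm_num) ?_
  have h1 : 1 / (10 * Real.log Q) ≤ 1 - betaOne Q := by linarith
  calc (1 : ℝ) / 10 = 1 / (10 * Real.log Q) * Real.log Q := by field_simp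
    _ ≤ (1 - betaOne Q) * Real.log Q := mul_le_mul_of_nonneg_right h1 (by linarith)

/-- **Instance `Q₀ = 10¹⁰`, CERTIFIED-NUMERICS version, McCurley-free** (leaf `NoRealZeroUpTo_1e10`
alone): for `10 ≤ Q ≤ 10¹⁰`, `1/10 ≤ min{1, (1 − β₁(Q)) log Q}`.
[cite: ThornerZaman2024LogFree, Theorem 1.2] [cite: McCurley1984ZFR, Theorem 1] -/
theorem tenth_le_dhFactor_upTo_1e10_of_leaf' (hW : NoRealZeroUpTo_1e10) {Q : ℝ} (h10 : 10 ≤ Q)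
    (hQ : Q ≤ 10 ^ 10) : 1 / 10 ≤ min 1 ((1 - betaOne Q) * Real.log Q) := by
  have hN : NoExceptionalZeroUpTo 10000000000 (1 / 10) :=
    NoRealZeroUpTo.noExceptionalZeroUpTo hW (1 / 10)
  exact tenth_le_dhFactor_of_noExceptionalZeroUpTo hN (by norm_num) h10 (by norm_num at hQ ⊢; exact hQ)

/-- **Instance `Q₀ = 10¹⁰`, PRINT version, McCurley-free** (Lu–Zaman–Zhao's Theorem 1.1 alone).
[cite: LuZamanZhao2026, Theorem 1.1] [cite: ThornerZaman2024LogFree, Theorem 1.2] -/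
theorem tenth_le_dhFactor_upTo_1e10' (h11 : luZamanZhao2026_theorem11) {Q : ℝ} (h10 : 10 ≤ Q)
    (hQ : Q ≤ 10 ^ 10) : 1 / 10 ≤ min 1 ((1 - betaOne Q) * Real.log Q) := by
  have hN : NoExceptionalZeroUpTo (10 ^ 10) (1 / 5) := noExceptionalZeroUpTo_of_luZamanZhao h11
  exact tenth_le_dhFactor_of_noExceptionalZeroUpTo hN (by norm_num) h10 (by norm_num at hQ ⊢; exact hQ)

end ThornerZaman2024

/-! ### The class-number-side readings (`SiegelZeroClassNumberBound.lean`), McCurley-free -/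

section QuadraticField

open Literature.NumberTheory.QuadraticFields Literature.NumberTheory.QuadraticFields.Quadratic

variable {K : Type*} [Field K] [NumberField K]

/-- **No Landau–Siegel zero of `L(s, χ_{d_K})` below `10¹⁰`, PRINT version, McCurley-free**
(Lu–Zaman–Zhao's Theorem 1.1 alone): the statement of `no_landauSiegelZero_quadraticField_upTo_1e10`
without `McCurley1984_theorem1`. [cite: LuZamanZhao2026, Corollary 1.2] -/
theorem no_landauSiegelZero_quadraticField_upTo_1e10' (h11 : luZamanZhao2026_theorem11)
    (hq : 400000 < (NumberField.discr K).natAbs) (hqQ : (NumberField.discr K).natAbs ≤ 10 ^ 10)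
    {β₁ : ℝ} (hlo : 1 - 1 / (10 * Real.log (NumberField.discr K).natAbs) < β₁) (hhi : β₁ < 1) :
    (jacobiChar (NumberField.discr K).natAbs).LFunction β₁ ≠ 0 :=
  BGTZ2025.no_landauSiegelZero_upTo_1e10' h11 (le_trans (by norm_num) hq.le) hqQ _ hlo hhi

/-- **The same, CERTIFIED-NUMERICS version, McCurley-free** (leaf `NoRealZeroUpTo_1e10` alone).
[cite: McCurley1984ZFR, Theorem 1] [cite: BenliGoelTwissZaman2025, Corollary 1.1 (Remarks)] -/
theorem no_landauSiegelZero_quadraticField_upTo_1e10_of_leaf' (hW : NoRealZeroUpTo_1e10)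
    (hq : 400000 < (NumberField.discr K).natAbs) (hqQ : (NumberField.discr K).natAbs ≤ 10 ^ 10)
    {β₁ : ℝ} (hlo : 1 - 1 / (10 * Real.log (NumberField.discr K).natAbs) < β₁) (hhi : β₁ < 1) :
    (jacobiChar (NumberField.discr K).natAbs).LFunction β₁ ≠ 0 :=
  BGTZ2025.no_landauSiegelZero_upTo_1e10_of_leaf' hW (le_trans (by norm_num) hq.le) hqQ _ hlo hhi

/-- **The same below `3·10¹⁰`, CERTIFIED-NUMERICS version, McCurley-free** (wide rung leaf
`NoRealZeroUpTo_3e10` alone). [cite: McCurley1984ZFR, Theorem 1]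
[cite: BenliGoelTwissZaman2025, Corollary 1.1 (Remarks)] -/
theorem no_landauSiegelZero_quadraticField_upTo_3e10_of_leaf' (hW : NoRealZeroUpTo_3e10)
    (hq : 400000 < (NumberField.discr K).natAbs) (hqQ : (NumberField.discr K).natAbs ≤ 3 * 10 ^ 10)
    {β₁ : ℝ} (hlo : 1 - 1 / (10 * Real.log (NumberField.discr K).natAbs) < β₁) (hhi : β₁ < 1) :
    (jacobiChar (NumberField.discr K).natAbs).LFunction β₁ ≠ 0 :=
  BGTZ2025.no_landauSiegelZero_upTo_3e10_of_leaf' hW (le_trans (by norm_num) hq.le) hqQ _ hlo hhi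

/-- **… and below `4·10¹⁰`** (wide rung leaf `NoRealZeroUpTo_4e10` alone).
[cite: McCurley1984ZFR, Theorem 1] [cite: BenliGoelTwissZaman2025, Corollary 1.1 (Remarks)] -/
theorem no_landauSiegelZero_quadraticField_upTo_4e10_of_leaf (hW : NoRealZeroUpTo_4e10)
    (hq : 400000 < (NumberField.discr K).natAbs) (hqQ : (NumberField.discr K).natAbs ≤ 4 * 10 ^ 10)
    {β₁ : ℝ} (hlo : 1 - 1 / (10 * Real.log (NumberField.discr K).natAbs) < β₁) (hhi : β₁ < 1) :
    (jacobiChar (NumberField.discr K).natAbs).LFunction β₁ ≠ 0 :=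
  BGTZ2025.no_landauSiegelZero_upTo_4e10_of_leaf hW (le_trans (by norm_num) hq.le) hqQ _ hlo hhi

end QuadraticField

end Literature.NumberTheory.LFunctions
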